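import Literature.NumberTheory.Automorphic.CompactCoreCentralizerDiagonalTranslation   -- (S4b-engine): (free)∕(gen) for a regular diagonal centraliser through `φ : G ↪ GL_N(E_w)`
import Literature.NumberTheory.Automorphic.IwasawaDecompositionGL                       -- ★ `IsUniformizingElement`, `exists_eq_zpow_mul_of_ne_zero`
import Literature.NumberTheory.Automorphic.UnitaryGroupIntegralPointsReductionInert      -- ★ `valuation_galAdicCompletionMap_eq`
import Literature.NumberTheory.Automorphic.UnitaryGroupInertPlaceHyperbolicBasis        -- ★ `galAdicCompletionMap_galAdicCompletionMap_of_smul_eq`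
import HarnessLib

/-!
# The split torus of `U(σ, H)` for an ANTIDIAGONAL hermitian plane: diagonal unitary elements are `diag(a, (σa)⁻¹)`, rank one in valuation, generator
# `τ = diag(ϖ, (σϖ)⁻¹)` (Rogawski (1990), §1.10 p. 9, §3.6 p. 31, §4.3 p. 43; Tits (1979), §3.9)

Topic `NumberTheory/Automorphic`; namespace `Literature.NumberTheory.Automorphic.UnitaryGroup`.  KERNEL mathematics only: theorems, no definition, no named fact, no
instance, no `sorry`.  Cell `pub/hodgecm-mathlib`, F0∕P3a, crux H413 = stmt-HodgeConjecture-24833, line «N6nsGerm», road (R2-ram) = RAMIFIED half of `stub_N6nsR2EP` (census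
`F0/P3a/A-p06/g27/CENSUS-R2ram-RamifiedEulerPoincare.A-p06g27.md` §5 (S4c); LEAD F0P3a-plan (g10) T9-8 (B); seat A-p06 (g27)).  HONEST LABEL: HC_CM is proved only modulo
the 2 remaining named inputs (hLiu418, h413) until rung 0 closes; this file discharges no named fact.

For a matrix `H ∈ M₂(E)` with `H₀₀ = H₁₁ = 0` (the hyperbolic ∕ antidiagonal plane `Φ₂ = antidiag(1, 1)` read at a place, and its rescalings):
* §1 (any commutative ring ∕ valued field) `map_apply_mul_apply_eq_one_of_mem_unitaryGroupOfForm` — a DIAGONAL `g = diag(e₀, e₁) ∈ U(σ, H)` has `σ(e₀)·e₁ = 1` (when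
  `H₀₁ ≠ 0` is not a zero divisor … we assume `E` a field); `valuation_apply_one_eq_inv` — hence `|e₁| = |e₀|⁻¹` for valuation-preserving `σ`; `mem_unitaryGroupOfForm_of_eq_diagonal` —
  conversely `diag(e₀, e₁) ∈ U(σ, H)` as soon as `σ(e₀) e₁ = 1 = σ(e₁) e₀`; `exists_valuation_apply_eq_zpow` — RANK ONE: with a uniformizing element `ϖ` (`𝒪` a DVR) and a diagonal
  `τ ∈ U(σ, H)` with `|τ₀₀| = |ϖ|`, every diagonal `g ∈ U(σ, H)` has `|gᵢᵢ| = |τᵢᵢ| ^ n` (`i = 0, 1`) for one `n ∈ ℤ`.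
* §2 (`E_w`, a topological group `G` closed-embedded by `φ` into `GL₂(E_w)` with image in `U(σ, H)`, `γ ∈ G` with REGULAR diagonal image, `τ ∈ Z_G(γ)` with `|φ(τ)₀₀| = |ϖ|`)
  **`eq_zero_of_zpow_mem_compactCore_centralizer_of_unitary`** (free) and **`exists_mul_zpow_inv_mem_compactCore_centralizer_of_unitary`** (gen) — the two split-torus
  hypotheses `hfree`, `hgen` of ★ (S4a) `classOrbitalIntegral_indicator_eq_mul_natCard_quotient_zpowers` (★ (S4b-engine) + §1).
Consumer (S4d): `G = U(Φ₂)(L⁺_v)` the CM carrier at a non-split `v`, `φ = subtype ∘ localNonsplitEquiv` (★ `isClosedEmbedding_subtype_comp_localNonsplitEquiv`), `σ = σ_w`,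
`H = (Φ₂)_w = antidiag(1, 1)` (★ `placeForm_antidiagTwo_eq`).

## References
* [Rogawski1990] J. D. Rogawski, *Automorphic Representations of Unitary Groups in Three Variables*, Ann. of Math. Stud. 123 (1990), §1.10 p. 9, §3.6 p. 31, §4.3 p. 43.
* [Tits1979] J. Tits, *Reductive groups over local fields*, PSPM 33.1 (1979), §3.9.
* [Serre1980Trees] J.-P. Serre, *Trees* (1980), II.1.1, II.1.3.
-/

set_option autoImplicit false

noncomputable section

open Matrix NumberField IsDedekindDomain Topology
open scoped MatrixGroups ValuativeRel
open ValuativeRel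

namespace Literature.NumberTheory.Automorphic.UnitaryGroup

open Literature.NumberTheory.Automorphic

/-! ## §1 Diagonal elements of `U(σ, H)`, `H₀₀ = H₁₁ = 0` -/

section Field

variable {E : Type*} [Field E] (σ : E →+* E) {H : Matrix (Fin 2) (Fin 2) E} (hH₀ : H 0 0 = 0) (hH₁ : H 1 1 = 0)

/-- The Gram matrix of `H` in a diagonal frame: `((σ·diag e)ᵀ H (diag e))ᵢⱼ = σ(eᵢ) Hᵢⱼ eⱼ`. [cite: Rogawski1990, §1.10 p. 9] -/
theorem map_diagonal_transpose_mul_mul_diagonal_apply (e : Fin 2 → E) (i j : Fin 2) :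
    (((diagonal e).map σ)ᵀ * H * diagonal e) i j = σ (e i) * H i j * e j := by
  rw [diagonal_map (map_zero σ), diagonal_transpose, mul_diagonal, diagonal_mul]

/-- **A diagonal element `diag(e₀, e₁)` of `U(σ, H)` (`H₀₁ ≠ 0`) has `σ(e₀) · e₁ = 1`.** [cite: Rogawski1990, §1.10 p. 9; §3.6 p. 31] -/
theorem map_apply_mul_apply_eq_one_of_mem_unitaryGroupOfForm (hH₀₁ : H 0 1 ≠ 0) {g : GL (Fin 2) E} (hg : g ∈ unitaryGroupOfForm σ H) {e : Fin 2 → E}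
    (hge : (g : Matrix (Fin 2) (Fin 2) E) = diagonal e) : σ (e 0) * e 1 = 1 := by
  have h := congrFun (congrFun (mem_unitaryGroupOfForm_iff.1 hg) 0) 1
  rw [hge, map_diagonal_transpose_mul_mul_diagonal_apply] at h
  -- `σ e₀ * H₀₁ * e₁ = H₀₁`
  have h2 : (σ (e 0) * e 1 - 1) * H 0 1 = 0 := by linear_combination h
  exact sub_eq_zero.1 ((mul_eq_zero.1 h2).resolve_right hH₀₁)

/-- … and, symmetrically (`H₁₀ ≠ 0`), `σ(e₁) · e₀ = 1`. [cite: Rogawski1990, §1.10 p. 9; §3.6 p. 31] -/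
theorem map_apply_one_mul_apply_zero_eq_one_of_mem_unitaryGroupOfForm (hH₁₀ : H 1 0 ≠ 0) {g : GL (Fin 2) E} (hg : g ∈ unitaryGroupOfForm σ H) {e : Fin 2 → E}
    (hge : (g : Matrix (Fin 2) (Fin 2) E) = diagonal e) : σ (e 1) * e 0 = 1 := by
  have h := congrFun (congrFun (mem_unitaryGroupOfForm_iff.1 hg) 1) 0
  rw [hge, map_diagonal_transpose_mul_mul_diagonal_apply] at h
  have h2 : (σ (e 1) * e 0 - 1) * H 1 0 = 0 := by linear_combination h
  exact sub_eq_zero.1 ((mul_eq_zero.1 h2).resolve_right hH₁₀)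

include hH₀ hH₁ in
/-- **Conversely, `diag(e₀, e₁) ∈ U(σ, H)` when `σ(e₀) e₁ = 1 = σ(e₁) e₀`** (`H₀₀ = H₁₁ = 0`; e.g. `τ = diag(ϖ, (σϖ)⁻¹)` for an involution `σ`).
[cite: Rogawski1990, §1.10 p. 9; §3.6 p. 31] -/
theorem mem_unitaryGroupOfForm_of_eq_diagonal {g : GL (Fin 2) E} {e : Fin 2 → E} (hge : (g : Matrix (Fin 2) (Fin 2) E) = diagonal e)
    (h₀ : σ (e 0) * e 1 = 1) (h₁ : σ (e 1) * e 0 = 1) : g ∈ unitaryGroupOfForm σ H := by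
  rw [mem_unitaryGroupOfForm_iff, hge]
  ext i j
  rw [map_diagonal_transpose_mul_mul_diagonal_apply]
  fin_cases i <;> fin_cases j
  · simp [hH₀]
  · calc σ (e 0) * H 0 1 * e 1 = σ (e 0) * e 1 * H 0 1 := by ring
      _ = H 0 1 := by rw [h₀, one_mul]
  · calc σ (e 1) * H 1 0 * e 0 = σ (e 1) * e 0 * H 1 0 := by ring
      _ = H 1 0 := by rw [h₁, one_mul]
  · simp [hH₁]

variable [ValuativeRel E] (hσv : ∀ x : E, valuation E (σ x) = valuation E x)

include hσv in
/-- **`|e₁| = |e₀|⁻¹` for a diagonal `diag(e₀, e₁) ∈ U(σ, H)`**, `σ` valuation-preserving, `H₀₁ ≠ 0`. [cite: Rogawski1990, §3.6 p. 31] [cite: Tits1979, §3.9] -/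
theorem valuation_apply_one_eq_inv (hH₀₁ : H 0 1 ≠ 0) {g : GL (Fin 2) E} (hg : g ∈ unitaryGroupOfForm σ H) {e : Fin 2 → E}
    (hge : (g : Matrix (Fin 2) (Fin 2) E) = diagonal e) : valuation E (e 1) = (valuation E (e 0))⁻¹ := by
  have h := congrArg (valuation E) (map_apply_mul_apply_eq_one_of_mem_unitaryGroupOfForm σ hH₀₁ hg hge)
  rw [map_mul, map_one, hσv] at h
  exact eq_inv_of_mul_eq_one_right h

include hσv in
/-- **RANK ONE IN VALUATION**: if `𝒪` is a DVR with uniformizing element `ϖ`, `τ = diag(t) ∈ U(σ, H)` has `|t₀| = |ϖ|`, and `g = diag(e) ∈ U(σ, H)`, then `|eᵢ| = |tᵢ| ^ n`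
(`i = 0, 1`) for one `n ∈ ℤ` (`|e₀| = |ϖ|^n`, `|e₁| = |e₀|⁻¹`, `|t₁| = |ϖ|⁻¹`). [cite: Tits1979, §3.9] [cite: Rogawski1990, §4.3 p. 43] -/
theorem exists_valuation_apply_eq_zpow [IsDiscreteValuationRing 𝒪[E]] {ϖ : E} (hϖ : IsUniformizingElement ϖ) (hH₀₁ : H 0 1 ≠ 0)
    {τ : GL (Fin 2) E} (hτ : τ ∈ unitaryGroupOfForm σ H) {t : Fin 2 → E} (hτt : (τ : Matrix (Fin 2) (Fin 2) E) = diagonal t) (ht₀ : valuation E (t 0) = valuation E ϖ)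
    {g : GL (Fin 2) E} (hg : g ∈ unitaryGroupOfForm σ H) {e : Fin 2 → E} (hge : (g : Matrix (Fin 2) (Fin 2) E) = diagonal e) :
    ∃ n : ℤ, ∀ i : Fin 2, valuation E (e i) = valuation E (t i) ^ n := by
  -- `e₀ ≠ 0` (`det g = e₀ e₁ ≠ 0`)
  have he₀ : e 0 ≠ 0 := by
    have hdet : (g : Matrix (Fin 2) (Fin 2) E).det ≠ 0 := (Matrix.isUnits_det_units g).ne_zero
    rw [hge, det_diagonal, Fin.prod_univ_two] at hdet
    exact left_ne_zero_of_mul hdet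
  obtain ⟨n, u, hu, hn⟩ := exists_eq_zpow_mul_of_ne_zero hϖ he₀
  have h0 : valuation E (e 0) = valuation E ϖ ^ n := by rw [hn, map_mul, map_zpow₀, hu, mul_one]
  refine ⟨n, ?_⟩
  rw [Fin.forall_fin_two, valuation_apply_one_eq_inv σ hσv hH₀₁ hg hge, valuation_apply_one_eq_inv σ hσv hH₀₁ hτ hτt, h0, ht₀, _root_.inv_zpow]
  exact ⟨rfl, rfl⟩

end Field

/-! ## §2 At `E_w`: (free) and (gen) for a group closed-embedded into `U(σ, H) ≤ GL₂(E_w)` -/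

section Place

open Literature.NumberTheory.GaloisRepresentations

variable {E : Type} [Field E] [NumberField E] (w : HeightOneSpectrum (𝓞 E)) (σ : w.adicCompletion E →+* w.adicCompletion E)
  (hσv : ∀ x : w.adicCompletion E, valuation (w.adicCompletion E) (σ x) = valuation (w.adicCompletion E) x)
  {H : Matrix (Fin 2) (Fin 2) (w.adicCompletion E)} (hH₀₁ : H 0 1 ≠ 0)
  {G : Type*} [Group G] [TopologicalSpace G] [IsTopologicalGroup G]
  (φ : G →* GL (Fin 2) (w.adicCompletion E)) (hφU : ∀ g : G, φ g ∈ unitaryGroupOfForm σ H)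
  {γ : G} {d : Fin 2 → w.adicCompletion E}
  (hγ : ((φ γ : GL (Fin 2) (w.adicCompletion E)) : Matrix (Fin 2) (Fin 2) (w.adicCompletion E)) = diagonal d) (hd : ∀ i j, i ≠ j → IsUnit (d i - d j))
  {ϖ : w.adicCompletion E} (hϖ : IsUniformizingElement ϖ) (τ : Subgroup.centralizer ({γ} : Set G))
  (hτ₀ : valuation (w.adicCompletion E) (((φ (τ : G) : GL (Fin 2) (w.adicCompletion E)) : Matrix (Fin 2) (Fin 2) (w.adicCompletion E)) 0 0) =
    valuation (w.adicCompletion E) ϖ)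

omit [IsTopologicalGroup G] in
include hγ hd hϖ hτ₀ in
/-- **(free) for the split torus of `U(σ, H)(E_w)`**: `τ ^ n ∈ compactCore Z_G(γ) → n = 0` (`|φ(τ)₀₀| = |ϖ| ≠ 1`; ★ (S4b-engine) `eq_zero_of_zpow_mem_compactCore_centralizer`).
[cite: Tits1979, §3.9] [cite: Serre1980Trees, II.1.3] -/
theorem eq_zero_of_zpow_mem_compactCore_centralizer_of_unitary (hφ : IsClosedEmbedding φ) (n : ℤ)
    (hn : τ ^ n ∈ compactCore (Subgroup.centralizer ({γ} : Set G))) : n = 0 :=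
  eq_zero_of_zpow_mem_compactCore_centralizer w φ hγ hd hφ τ (i := 0) (by rw [hτ₀]; exact hϖ.valuation_lt_one.ne) n hn

include hσv hH₀₁ hφU hγ hd hϖ hτ₀ in
/-- **(gen) for the split torus of `U(σ, H)(E_w)`** (`𝒪_w` a DVR, `ϖ` uniformizing, `H₀₁ ≠ 0`, `σ` valuation-preserving, `φ(G) ≤ U(σ, H)`): every `c ∈ Z_G(γ)` has
`c · τ^{−n} ∈ compactCore Z_G(γ)` for some `n ∈ ℤ` (rank one §1 + ★ (S4b-engine) `exists_mul_zpow_inv_mem_compactCore_centralizer`). [cite: Tits1979, §3.9] [cite: Rogawski1990, §4.3 p. 43] -/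
theorem exists_mul_zpow_inv_mem_compactCore_centralizer_of_unitary [IsDiscreteValuationRing 𝒪[w.adicCompletion E]] (hφ : IsClosedEmbedding φ)
    (c : Subgroup.centralizer ({γ} : Set G)) : ∃ n : ℤ, c * (τ ^ n)⁻¹ ∈ compactCore (Subgroup.centralizer ({γ} : Set G)) := by
  refine exists_mul_zpow_inv_mem_compactCore_centralizer w φ hγ hd hφ τ (fun c' => ?_) c
  exact exists_valuation_apply_eq_zpow σ hσv hϖ hH₀₁ (hφU (τ : G)) (coe_apply_eq_diagonal_of_mem_centralizer w φ hγ hd τ.2) hτ₀ (hφU (c' : G))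
    (coe_apply_eq_diagonal_of_mem_centralizer w φ hγ hd c'.2)

end Place

/-! ## §3 The CM ∕ quadratic carrier `U(J)(F_v)` at a NON-SPLIT place: the generator `τ = e⁻¹ diag(ϖ, (σ_w ϖ)⁻¹)` -/

section Carrier

open Literature.NumberTheory.GaloisRepresentations

variable {F E : Type} [Field F] [NumberField F] [Field E] [NumberField E] [Algebra F E] [Algebra.IsQuadraticExtension F E]
  (c : E ≃ₐ[F] E) (J : Matrix (Fin 2) (Fin 2) E) {v : HeightOneSpectrum (𝓞 F)} (hc : c ≠ 1) (w : PlacesOver E v) (hw : c • w.1 = w.1)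

/-- **THE SPLIT-TORUS GENERATOR ON THE CARRIER `U(J)(F_v)`, `v` non-split, `J_w` antidiagonal-shaped** (`(J_w)₀₀ = (J_w)₁₁ = 0 ≠ (J_w)₀₁`; e.g. `J = Φ₂`): if the one-place
image `e γ ∈ U(σ_w, J_w)(E_w)` of `γ` is a REGULAR diagonal matrix, then for every uniformizing `ϖ` of `E_w` (`𝒪_w` a DVR) the element `τ := e⁻¹ diag(ϖ, (σ_w ϖ)⁻¹)` lies in
`Z(γ)` and satisfies (gen) `∀ c ∈ Z(γ), ∃ n, c·τ^{−n} ∈ compactCore Z(γ)` and (free) `τ^n ∈ compactCore Z(γ) → n = 0` — the hypotheses `hgen`, `hfree` of ★ (S4a)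
`classOrbitalIntegral_indicator_eq_mul_natCard_quotient_zpowers` (§2 along `φ = subtype ∘ e`, ★ `isClosedEmbedding_subtype_comp_localNonsplitEquiv`).
[cite: Tits1979, §3.9] [cite: Rogawski1990, §3.6 p. 31; §4.3 p. 43] [cite: Serre1980Trees, II.1.3] -/
theorem exists_splitTorus_generator_local_of_nonsplit
    (hJ₀₀ : placeForm J w.1 0 0 = 0) (hJ₁₁ : placeForm J w.1 1 1 = 0) (hJ₀₁ : placeForm J w.1 0 1 ≠ 0)
    [IsDiscreteValuationRing 𝒪[w.1.adicCompletion E]] {ϖ : w.1.adicCompletion E} (hϖ : IsUniformizingElement ϖ)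
    {γ : «local» E c 2 J v} {d : Fin 2 → w.1.adicCompletion E}
    (hγ : (((localNonsplitEquiv c J hc w hw γ : unitaryGroupOfForm (galAdicCompletionMap (L := E) c hw) (placeForm J w.1)) :
      GL (Fin 2) (w.1.adicCompletion E)) : Matrix (Fin 2) (Fin 2) (w.1.adicCompletion E)) = diagonal d) (hd : ∀ i j, i ≠ j → IsUnit (d i - d j)) :
    ∃ τ : Subgroup.centralizer ({γ} : Set («local» E c 2 J v)),
      (((localNonsplitEquiv c J hc w hw (τ : «local» E c 2 J v) : unitaryGroupOfForm (galAdicCompletionMap (L := E) c hw) (placeForm J w.1)) :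
          GL (Fin 2) (w.1.adicCompletion E)) : Matrix (Fin 2) (Fin 2) (w.1.adicCompletion E)) = diagonal ![ϖ, (galAdicCompletionMap (L := E) c hw ϖ)⁻¹] ∧
      (∀ c' : Subgroup.centralizer ({γ} : Set («local» E c 2 J v)), ∃ n : ℤ, c' * (τ ^ n)⁻¹ ∈ compactCore (Subgroup.centralizer ({γ} : Set («local» E c 2 J v)))) ∧
      (∀ n : ℤ, τ ^ n ∈ compactCore (Subgroup.centralizer ({γ} : Set («local» E c 2 J v))) → n = 0) := by
  set σ := galAdicCompletionMap (L := E) c hw with hσdef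
  set e := localNonsplitEquiv c J hc w hw with hedef
  have hσσ : ∀ x, σ (σ x) = x := galAdicCompletionMap_galAdicCompletionMap_of_smul_eq c w hc hw
  have hσv : ∀ x : w.1.adicCompletion E, valuation (w.1.adicCompletion E) (σ x) = valuation (w.1.adicCompletion E) x :=
    fun x => valuation_galAdicCompletionMap_eq c v w hw x
  have hϖ0 : ϖ ≠ 0 := hϖ.ne_zero
  have hσϖ0 : σ ϖ ≠ 0 := (map_ne_zero σ).2 hϖ0
  -- the diagonal unitary `τ_U = diag(ϖ, (σϖ)⁻¹)`
  have ht : ∀ i, (![ϖ, (σ ϖ)⁻¹] : Fin 2 → w.1.adicCompletion E) i ≠ 0 := by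
    rw [Fin.forall_fin_two]
    exact ⟨hϖ0, inv_ne_zero hσϖ0⟩
  set τU : GL (Fin 2) (w.1.adicCompletion E) := glDiagonal 2 (w.1.adicCompletion E) fun i => Units.mk0 ((![ϖ, (σ ϖ)⁻¹] : Fin 2 → w.1.adicCompletion E) i) (ht i)
    with hτUdef
  have hτUt : (τU : Matrix (Fin 2) (Fin 2) (w.1.adicCompletion E)) = diagonal ![ϖ, (σ ϖ)⁻¹] := by rw [hτUdef, coe_glDiagonal]; rfl
  have hτUmem : τU ∈ unitaryGroupOfForm σ (placeForm J w.1) := by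
    refine mem_unitaryGroupOfForm_of_eq_diagonal σ hJ₀₀ hJ₁₁ hτUt ?_ ?_
    · show σ ϖ * (σ ϖ)⁻¹ = 1
      exact mul_inv_cancel₀ hσϖ0
    · show σ (σ ϖ)⁻¹ * ϖ = 1
      rw [map_inv₀, hσσ, inv_mul_cancel₀ hϖ0]
  -- pull it back to the carrier
  set τG : «local» E c 2 J v := e.symm ⟨τU, hτUmem⟩ with hτGdef
  have heτ : e τG = ⟨τU, hτUmem⟩ := e.apply_symm_apply _
  have hτZ : τG ∈ Subgroup.centralizer ({γ} : Set («local» E c 2 J v)) := by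
    rw [Subgroup.mem_centralizer_singleton_iff]
    apply e.injective
    rw [map_mul, map_mul, heτ]
    apply Subtype.ext
    apply Units.ext
    change (τU : Matrix (Fin 2) (Fin 2) (w.1.adicCompletion E)) * ((e γ : unitaryGroupOfForm σ (placeForm J w.1)) : GL (Fin 2) (w.1.adicCompletion E)) =
      (((e γ : unitaryGroupOfForm σ (placeForm J w.1)) : GL (Fin 2) (w.1.adicCompletion E)) : Matrix (Fin 2) (Fin 2) (w.1.adicCompletion E)) * τU
    rw [hτUt, hγ, diagonal_mul_diagonal, diagonal_mul_diagonal]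
    congr 1
    funext i
    exact mul_comm _ _
  -- the closed embedding `φ = subtype ∘ e`
  have hφ := isClosedEmbedding_subtype_comp_localNonsplitEquiv c 2 J hc w hw
  have hφU : ∀ g : «local» E c 2 J v,
      ((unitaryGroupOfForm σ (placeForm J w.1)).subtype.comp e.toMonoidHom) g ∈ unitaryGroupOfForm σ (placeForm J w.1) := fun g => (e g).2
  have hγ' : ((((unitaryGroupOfForm σ (placeForm J w.1)).subtype.comp e.toMonoidHom) γ : GL (Fin 2) (w.1.adicCompletion E)) :
      Matrix (Fin 2) (Fin 2) (w.1.adicCompletion E)) = diagonal d := hγ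
  have hτ₀ : valuation (w.1.adicCompletion E) (((((unitaryGroupOfForm σ (placeForm J w.1)).subtype.comp e.toMonoidHom)
      ((⟨τG, hτZ⟩ : Subgroup.centralizer ({γ} : Set («local» E c 2 J v))) : «local» E c 2 J v) : GL (Fin 2) (w.1.adicCompletion E)) :
        Matrix (Fin 2) (Fin 2) (w.1.adicCompletion E)) 0 0) = valuation (w.1.adicCompletion E) ϖ := by
    change valuation (w.1.adicCompletion E) ((((e τG : unitaryGroupOfForm σ (placeForm J w.1)) : GL (Fin 2) (w.1.adicCompletion E)) :
      Matrix (Fin 2) (Fin 2) (w.1.adicCompletion E)) 0 0) = valuation (w.1.adicCompletion E) ϖ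
    rw [heτ]
    change valuation (w.1.adicCompletion E) ((τU : Matrix (Fin 2) (Fin 2) (w.1.adicCompletion E)) 0 0) = valuation (w.1.adicCompletion E) ϖ
    rw [hτUt, diagonal_apply_eq]
    rfl
  refine ⟨⟨τG, hτZ⟩, ?_, fun c' => ?_, fun n hn => ?_⟩
  · change (((e τG : unitaryGroupOfForm σ (placeForm J w.1)) : GL (Fin 2) (w.1.adicCompletion E)) : Matrix (Fin 2) (Fin 2) (w.1.adicCompletion E)) =
      diagonal ![ϖ, (σ ϖ)⁻¹]
    rw [heτ]
    exact hτUt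
  · exact exists_mul_zpow_inv_mem_compactCore_centralizer_of_unitary w.1 σ hσv hJ₀₁ _ hφU hγ' hd hϖ ⟨τG, hτZ⟩ hτ₀ hφ c'
  · exact eq_zero_of_zpow_mem_compactCore_centralizer_of_unitary w.1 _ hγ' hd hϖ ⟨τG, hτZ⟩ hτ₀ hφ n hn

end Carrier


end Literature.NumberTheory.Automorphic.UnitaryGroup

end
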